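import Summits.BirchSwinnertonDyer.BirchSwinnertonDyer.Theorems.EisensteinPrimesDatumSelmerQuotientCorankGeneric
import Summits.BirchSwinnertonDyer.BirchSwinnertonDyer.Theorems.EisensteinPrimesInertiaTorsionCardGeneric
import Summits.BirchSwinnertonDyer.BirchSwinnertonDyer.Theorems.EisensteinPrimesDecompositionCountNumPlaces
import Summits.BirchSwinnertonDyer.BirchSwinnertonDyer.Theorems.EisensteinPrimesUnrSelmerQuotientTorsionFiniteChar
import HarnessLib

/-!
# `corank_{ℤ_p}(H¹_{𝓕_nr^{Sf}}/H¹_{𝓕_nr}) ≤ Σ_{w∈Sf} [Γ : Γ_w]` for Keller–Yin's character modules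
# `(F/𝒪)(θ)` over the anticyclotomic tower — IN THE KERNEL (the place-count half of the `≤` side
# of the `S`-relaxation corank identity `prop125_residualPair_unrSelmer_corank`)

Cell `bsd-eis` (home `run/shared/lean/pub/bsd-eis/`), seat `bsd-line-x1-p1` (LEAD, D-0154 row 4),
crux 2 `GoodLatticeBDPValue` (stmt-BirchSwinnertonDyer-19032), line `halves` v14, stub
`stub_imprimCorank`. That stub's first conjunct is the typed PUB-composed identity
`zpCorank (H¹_{𝓕_nr^{Sf}}/H¹_{𝓕_nr}) p = Σ_{w∈Sf} λ𝒫_w(θ)` (Pollack–Weston 2011 Prop. A.2 ∘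
KY/CGLS Lemma 1.1.1; `λ𝒫_w(θ) = charLocalLambda ∅ κ θ w = [Γ : Γ_w] · 𝟙[θ(Frob_w) ≡ Nw]`). The
`≥` half is the surjectivity of the global-to-local map (Poitou–Tate; PUB, not attempted). This file
proves the first KERNEL piece of the `≤` half — the quotient embeds in `∏_{w∈Sf} ∏_{η∣w} H¹(I_η, A)`,
each factor of `ℤ_p`-corank `≤ 1`:

* **`zpCorank_unrSelmer_quotient_le_sum_numPlacesAbove`** — for `K` imaginary quadratic, `p` odd,
  `κ` anticyclotomic with topological generator `γ`, ANY character `θ : Γ_K → GL₁(ℤ_p)`, any `vbar`,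
  and `Sf` = the primes of `K` over `N` ((Heeg) for `N`, `p ∤` the members of `Sf`):
  `zpCorank (H¹_{𝓕_nr^{Sf}}(K_∞, (F/𝒪)(θ)) / H¹_{𝓕_nr}(K_∞, (F/𝒪)(θ))) p ≤ Σ_{w∈Sf} numPlacesAbove κ w`.

Assembly of `DatumSelmerQuotientCorankGeneric.zpCorank_quotient_le_sum` (generic quotient bound) with
`N_w = numPlacesAbove κ w` (`DecompositionCountNumPlaces.hrep_numPlacesAbove`; every `w ∈ Sf` is split,
hence finitely decomposed in the anticyclotomic tower by Brink 2007 — tree theorem, via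
`UnrSelmerQuotientTorsionFiniteChar.exists_mem_decomp_apply_ne_one_of_heegner`) and `c_w = 1`
(`InertiaTorsionCardGeneric.zpCorank_le_one_of_natCard_torsionBy_eq`, `#((F/𝒪)(θ))[p] = p`). The
sharpening `c_w = 𝟙[θ(Frob_w) ≡ Nw]` (i.e. the bound `Σ charLocalLambda`) is the sequel.

HONEST FRAMING: theorems only (no definition, no named fact, no `sorry`); nothing booked; BSD /
Mazur's MC proved for no curve; the stub `stub_imprimCorank` is NOT closed by this (it is an
equality whose `≥` half is Pollack–Weston A.2).

References: [GreenbergVatsal2000] §2 pp. 17, 20–22 (Cor. (2.3), Prop. (2.4)); [KellerYin2024] proof of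
Prop. 1.2.5 (eq:Gr to imp), Lemma 1.1.1 (arXiv:2402.12781v2 TeX L789–800, L455–462);
[CastellaGrossiLeeSkinner2022] proof of Prop. 1.2.5; [PollackWeston2011] App. A Prop. A.2;
[Brink2007] Thm. 2.
-/

set_option linter.dupNamespace false
set_option autoImplicit false

noncomputable section

open scoped Classical AddSubgroup

open WeierstrassCurve NumberField IsDedekindDomain Field
  Literature.NumberTheory.EllipticCurves Literature.NumberTheory.EllipticCurves.Castella2018
  Literature.NumberTheory.EllipticCurves.GreenbergSelmer
  Literature.NumberTheory.EllipticCurves.GreenbergVatsal2000 Literature.NumberTheory.GaloisRepresentations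
  Literature.NumberTheory.EllipticCurves.KellerYin2024
open Summit.BirchSwinnertonDyer.BirchSwinnertonDyer.Theorems
  Summit.BirchSwinnertonDyer.BirchSwinnertonDyer.Theorems.IwasawaTwoVariable
  Summit.BirchSwinnertonDyer.BirchSwinnertonDyer.Theorems.DatumSelmerQuotientCorankGeneric
  Summit.BirchSwinnertonDyer.BirchSwinnertonDyer.Theorems.InertiaTorsionCardGeneric
  Summit.BirchSwinnertonDyer.BirchSwinnertonDyer.Theorems.DecompositionCountNumPlaces
  Summit.BirchSwinnertonDyer.BirchSwinnertonDyer.Theorems.UnrSelmerQuotientTorsionFiniteChar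

namespace Summit.BirchSwinnertonDyer.BirchSwinnertonDyer.Theorems.UnrSelmerQuotientCorankChar

variable {K : Type} [Field K] [NumberField K] {p : ℕ} [Fact p.Prime]

/-- **Generic per-character bound with arbitrary per-place constants.** For ANY `ℤ_p`-extension `κ`
of a number field `K` with topological generator `γ`, any character `θ : Γ_K → GL₁(ℤ_p)`, any
`vbar`, and a finite set `Sf` of places `w ∤ p` each finitely decomposed in `K_∞` (`hD`), and per-place
bounds `c_w` on the corank of every subgroup of the image of `H¹(K_∞, (F/𝒪)(θ)) → H¹(I_w(K_∞), (F/𝒪)(θ))`: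
`zpCorank (H¹_{𝓕_nr^{Sf}}/H¹_{𝓕_nr}) p ≤ Σ_{w∈Sf} numPlacesAbove κ w · c_w`. (The generic quotient
bound at the character module — `p`-primary, `p`-divisible, `#(·)[p] = p`, open stabilisers — with
the optimal representative count.) [cite: GreenbergVatsal2000, §2 pp. 17, 20–22]
[cite: KellerYin2024, proof of Prop. 1.2.5 (eq:Gr to imp) (arXiv:2402.12781v2 TeX L789–800)] -/
theorem zpCorank_unrSelmer_quotient_le_sum_of_loc (κ : ZpExtension K p)
    {γ : absoluteGaloisGroup K} (hγ : κ.IsTopGenerator γ) (vbar : HeightOneSpectrum (𝓞 K))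
    (θ : FramedGaloisRep K (padicCoeffIntegers (∅ : Set (PadicAlgCl p))) 1)
    (Sf : Finset (HeightOneSpectrum (𝓞 K))) (hSp : ∀ w ∈ Sf, ((p : ℕ) : 𝓞 K) ∉ w.asIdeal)
    (hD : ∀ w ∈ Sf, ∃ δ ∈ decomp (K := K) w, κ δ ≠ 1) (c : HeightOneSpectrum (𝓞 K) → ℕ)
    (hloc : ∀ w ∈ Sf, ∀ Y : AddSubgroup (discreteH1 (inertiaIn κ.kerSubgroup w)
        (charModule (∅ : Set (PadicAlgCl p)) θ)),
      (∀ y ∈ Y, ∃ x : subgroupH1 κ.kerSubgroup (charModule (∅ : Set (PadicAlgCl p)) θ),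
        resH1Hom (inertiaInToH κ.kerSubgroup w) (AddMonoidHom.id _) (fun _ _ ↦ rfl) x = y) →
      zpCorank Y p ≤ c w) :
    zpCorank (↥(unrSelmer κ (charModule (∅ : Set (PadicAlgCl p)) θ) vbar
        (↑Sf : Set (HeightOneSpectrum (𝓞 K)))) ⧸
      (unrSelmer κ (charModule (∅ : Set (PadicAlgCl p)) θ) vbar
          (∅ : Set (HeightOneSpectrum (𝓞 K)))).addSubgroupOf
        (unrSelmer κ (charModule (∅ : Set (PadicAlgCl p)) θ) vbar
          (↑Sf : Set (HeightOneSpectrum (𝓞 K))))) p ≤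
      ∑ w ∈ Sf, numPlacesAbove κ w * c w := by
  haveI := finite_torsionBy_charModule θ
  exact zpCorank_quotient_le_sum κ (M := charModule (∅ : Set (PadicAlgCl p)) θ)
    ⟨1, by rw [natCard_torsionBy_charModule, pow_one]⟩
    (exists_pow_smul_cofree_eq_zero (∅ : Set (PadicAlgCl p)) θ) (exists_nsmul_eq_charModule θ)
    (isOpen_stabilizer_cofree (∅ : Set (PadicAlgCl p)) θ)
    (AcSelmer.bdpData (charModule (∅ : Set (PadicAlgCl p)) θ) p vbar) Sf hSp
    (fun w ↦ numPlacesAbove κ w) c (hrep_numPlacesAbove κ hγ Sf hD) hloc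

/-- **`corank_{ℤ_p}(H¹_{𝓕_nr^{Sf}}(K_∞, (F/𝒪)(θ)) / H¹_{𝓕_nr}(K_∞, (F/𝒪)(θ))) ≤ Σ_{w∈Sf} [Γ : Γ_w]`**
for `K` imaginary quadratic, `p` odd, `κ` ANTICYCLOTOMIC with topological generator `γ`, any `vbar`,
ANY character `θ : Γ_K → GL₁(ℤ_p)`, and `Sf` = the primes of `K` over `N` with (Heeg) for `N` and
`p ∉ w` for `w ∈ Sf`: the `S`-relaxation quotient embeds in `∏_{w∈Sf} ∏_{η∣w} H¹(I_η, (F/𝒪)(θ))`, a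
product of `Σ_{w} numPlacesAbove κ w` groups of `ℤ_p`-corank `≤ 1`. The place-count half of the
`≤` side of KY/CGLS Prop. 1.2.5's "(eq:Gr to imp) `0 → H¹_{𝓕_nr} → H¹_{𝓕_nr^S} → ∏_{w∈S} H¹(K_w, M_θ)
→ 0` … `H¹(K_w, M_θ)^∨` is `Λ`-torsion with characteristic ideal `(𝒫_w(θ))`" (there
`λ(𝒫_w(θ)) ≤ [Γ : Γ_w]`, tree `charLocalLambda_le`). [cite: KellerYin2024, Prop. 1.2.5 and Lemma 1.1.1 (arXiv:2402.12781v2 TeX L780–800, L455–462)]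
[cite: CastellaGrossiLeeSkinner2022, Prop. 1.2.5 (proof, (eq:sur1)–(eq:sur2))]
[cite: GreenbergVatsal2000, §2 pp. 20–22 (Cor. (2.3), Prop. (2.4))] [cite: Brink2007, Thm. 2] -/
theorem zpCorank_unrSelmer_quotient_le_sum_numPlacesAbove (hK : IsImaginaryQuadratic K)
    (hp : 2 < p) {N : ℕ} (hH : SatisfiesHeegnerHypothesis N K) (κ : ZpExtension K p)
    (hκ : κ.IsAnticyclotomic) {γ : absoluteGaloisGroup K} (hγ : κ.IsTopGenerator γ)
    (vbar : HeightOneSpectrum (𝓞 K))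
    (θ : FramedGaloisRep K (padicCoeffIntegers (∅ : Set (PadicAlgCl p))) 1)
    (Sf : Finset (HeightOneSpectrum (𝓞 K)))
    (hSf : ∀ w : HeightOneSpectrum (𝓞 K), w ∈ Sf ↔ ((N : ℤ) : 𝓞 K) ∈ w.asIdeal)
    (hSp : ∀ w ∈ Sf, ((p : ℕ) : 𝓞 K) ∉ w.asIdeal) :
    zpCorank (↥(unrSelmer κ (charModule (∅ : Set (PadicAlgCl p)) θ) vbar
        (↑Sf : Set (HeightOneSpectrum (𝓞 K)))) ⧸
      (unrSelmer κ (charModule (∅ : Set (PadicAlgCl p)) θ) vbar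
          (∅ : Set (HeightOneSpectrum (𝓞 K)))).addSubgroupOf
        (unrSelmer κ (charModule (∅ : Set (PadicAlgCl p)) θ) vbar
          (↑Sf : Set (HeightOneSpectrum (𝓞 K))))) p ≤
      ∑ w ∈ Sf, numPlacesAbove κ w := by
  haveI := finite_torsionBy_charModule θ
  have h := zpCorank_unrSelmer_quotient_le_sum_of_loc κ hγ vbar θ Sf hSp
    (fun w hw ↦ exists_mem_decomp_apply_ne_one_of_heegner hK hp hH κ hκ w ((hSf w).mp hw)
      (hSp w hw))
    (fun _ ↦ 1)
    (fun w hw Y _ ↦ (zpCorank_le_one_of_natCard_torsionBy_eq κ w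
      (M := charModule (∅ : Set (PadicAlgCl p)) θ) (natCard_torsionBy_charModule θ)
      (exists_nsmul_eq_charModule θ) (isOpen_stabilizer_cofree (∅ : Set (PadicAlgCl p)) θ)
      (hSp w hw) Y).2)
  simpa only [mul_one] using h

end Summit.BirchSwinnertonDyer.BirchSwinnertonDyer.Theorems.UnrSelmerQuotientCorankChar

end
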